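/-
Copyright (c) 2026 the pub-hodgecm-mathlib formalisation cell (harness21).  Prover seat hodgecm-mathlib-LH7-p04 (g8): N8-INNER brick (J) «ONE-PLACE JUMPS FROM THE ★ GLOBAL (I₃)»,
PART 1 (the tensor test functions), dealt by the road owner LH2-plan (g1) 2026-09-02; consumer (C′) F0P3a-p03.
-/
import Literature.NumberTheory.Rogawski1990.ArchBouazizClassMultiplierG        -- ★ (7′) LH3-p04: `snd_coe_coe_apply`, the `ArchSmooth.classMul` idiom; brings ★ `exists_contDiff_hasCompactSupport_of_isArchSmooth`, `contDiff_apply_snd_apply`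
import Literature.NumberTheory.Rogawski1990.ArchBouazizPositiveTestFunctionG    -- ★ F5 LH5-p03: `exists_real_archSmooth_pos_on` (a real non-negative `C_c^∞(G′_∞)` function positive on a compact set)
import Mathlib.Analysis.SpecialFunctions.SmoothTransition
import HarnessLib

/-!
# `C_c^∞(G′_∞)` contains the ambient multiples, the plateau functions and the TENSORS of one-place test functions

Topic `NumberTheory/Rogawski1990`; namespace `Literature.NumberTheory.Rogawski1990`.  THEOREMS ONLY (no definition, no instance, no notation, no named fact, no `sorry`);
kernel lane `--supports stmt-HodgeConjecture-24833`.  Cell `pub/hodgecm-mathlib` (D-0151), crux H413; HCML «GO 500» road N8-INNER (owner∕dealer LH2-plan (g1)), brick (J)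
«ONE-PLACE JUMPS FROM THE ★ GLOBAL (I₃)» PART 1 = the TEST-FUNCTION half of the tensor trick: the ★ global jump theorem ★ `hasOneSidedJump_hcTwistedDeriv_orbFamGExt_wall02_of_ne_zero`
speaks about `a′ ∈ ArchSmooth L 3 (diag α)` (the class `C_c^∞(G′_∞)` BY RESTRICTION from `GL₃(L ⊗ ℝ)`), while the one-place bricks of the road ((KN), (IT), (C′)) speak about ONE-PLACE
test functions `f_w : U(α)_w → ℂ` that are restrictions of ambient `C^∞` functions on `M₃(ℂ)` with compact support on the group.  This file proves that the TENSOR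
`k ↦ Π_w f_w((e k)_w)` (`e =` ★ `archPiEquivCM`) of such one-place data IS `ArchSmooth` — the (E2)∕(GT) item «`archSmooth_tensor`» — so that PART 2 may feed tensors to the ★ global
(I₃).  HONEST LABEL: count-neutral calculus plumbing; HC_CM is proved only modulo the 7 printed citations (2 remaining: hLiu418 = stmt-HodgeConjecture-24832, h413 =
stmt-HodgeConjecture-24833) until rung 0 closes.

WHAT IS PROVED.
* §1 `ArchSmooth.ambientMul` — `C_c^∞(G′_∞)` is a module over the ambient `C^∞(M₃(L ⊗ ℝ))`: `k ↦ Ψ(k) · a′ k` is `ArchSmooth` for `Ψ` of class `C^∞` on `M₃(L ⊗ ℝ)` (★ `ArchSmooth.classMul`'s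
  proof with the class map replaced by a general `Ψ`); `ArchSmooth.comp_real` — post-composition of a REAL `ArchSmooth` function with a `C^∞` `G : ℝ → ℝ`, `G 0 = 0`.
* §2 `exists_real_archSmooth_eq_one_on` — PLATEAU FUNCTIONS: for a compact `E ⊆ G′_∞` a real `ArchSmooth` `f`, `0 ≤ f ≤ 1`, `f = 1` on `E` (★ F5's positive function pushed through
  Mathlib's `Real.smoothTransition`).
* §3 `continuous_tensor`, `hasCompactSupport_tensor`, `tensor_eq_ambient`, **`archSmooth_tensor`** — the tensor of one-place ambient-smooth compactly supported test functions is continuous,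
  compactly supported, the restriction of the ambient `C^∞` function `X ↦ Π_w fa_w((X_{ij})_w)`, and `ArchSmooth` (§1 applied to the plateau of §2 on its support).

## References
* [BorelJacquet1979] A. Borel, H. Jacquet, *Automorphic forms and automorphic representations*, PSPM 33.1 (1979), §1.1, §4.1 (`C_c^∞(G_∞)`; tensors over the places).
* [Bouaziz1994IntegralesOrbitales] A. Bouaziz, *Intégrales orbitales sur les algèbres de Lie réductives*, Invent. Math. 115 (1994), §2.3 p. 578 (test functions).
* [Rogawski1990] J. D. Rogawski, *Automorphic Representations of Unitary Groups in Three Variables*, Ann. of Math. Stud. 123 (1990), §14.2 p. 233 (`f′_∞ = ⊗_v f′_v ∈ C_c^∞(G′_∞)`).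
-/

set_option autoImplicit false

noncomputable section

open NumberField NumberField.InfinitePlace NumberField.mixedEmbedding Matrix Complex Set Filter Topology Function
open scoped MatrixGroups Matrix Classical ContDiff
open Literature.NumberTheory.Automorphic Literature.NumberTheory.Automorphic.UnitaryGroup

namespace Literature.NumberTheory.Rogawski1990

/-! ## §1 Ambient multipliers and real post-composition -/

section Ambient

variable (L : Type) [Field L] [NumberField L] [IsCMField L] (α : Fin 3 → L)

-- the scoped `ℓ^∞`-operator norm on `M₃(L ⊗ ℝ)` (the one through which ★ `IsArchSmooth` is defined)
open scoped Matrix.Norms.Operator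

set_option backward.isDefEq.respectTransparency false in
/-- **`C_c^∞(G′_∞)` IS A MODULE OVER THE AMBIENT `C^∞(M₃(L ⊗ ℝ))`**: for `a′ ∈ ArchSmooth L 3 (diag α)` and `Ψ : M₃(L ⊗ ℝ) → ℂ` of class `C^∞`, `k ↦ Ψ(k) · a′ k` is `ArchSmooth`.  Witness on
`GL₃(L ⊗ ℝ)`: `(Ψ ∘ val) · φ` with `φ` the witness of `a′` and `Θ` its `C^∞` ambient lift (★ `exists_contDiff_hasCompactSupport_of_isArchSmooth`): continuous, support inside that of `φ`,
smooth along `X ↦ y · exp X` (★ `contDiff_exp_matrix_mixedSpace`). [cite: BorelJacquet1979, §4.1] [cite: Bouaziz1994IntegralesOrbitales, §2.3 p. 578] -/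
theorem ArchSmooth.ambientMul {a' : ↥(arch (↥(maximalRealSubfield L)) L (IsCMField.complexConj L) 3 (Matrix.diagonal α)) → ℂ} (ha' : ArchSmooth L 3 (Matrix.diagonal α) a')
    {Ψ : Matrix (Fin 3) (Fin 3) (mixedSpace L) → ℂ} (hΨ : ContDiff ℝ ∞ Ψ) :
    ArchSmooth L 3 (Matrix.diagonal α) (fun k => Ψ ((k : GL (Fin 3) (mixedSpace L)) : Matrix (Fin 3) (Fin 3) (mixedSpace L)) * a' k) := by
  obtain ⟨φ, hφc, hφs, hφsm, hφa⟩ := ha'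
  obtain ⟨Θ, hΘ, -, -, hΘφ⟩ := exists_contDiff_hasCompactSupport_of_isArchSmooth φ hφs hφsm
  refine ⟨fun g => Ψ (g : Matrix (Fin 3) (Fin 3) (mixedSpace L)) * φ g, ?_, hφs.mul_left, fun y => ?_, fun k => ?_⟩
  · exact (hΨ.continuous.comp Units.continuous_val).mul hφc
  · -- Mathlib idiom (Mathlib/Algebra/Lie/OfAssociative.lean): the Lie structure on `M₃(L ⊗ ℝ)` through which ★ `archGroupGL` speaks
    letI : LieRing (Matrix (Fin 3) (Fin 3) (mixedSpace L)) := LieRing.ofAssociativeRing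
    letI : LieAlgebra ℝ (Matrix (Fin 3) (Fin 3) (mixedSpace L)) := LieAlgebra.ofAssociativeAlgebra
    show ContDiff ℝ ∞ fun X : (archGroupGL 3 L).lie.toSubmodule =>
      Ψ (((y : GL (Fin 3) (mixedSpace L)) * expGL (X : Matrix (Fin 3) (Fin 3) (mixedSpace L)) : GL (Fin 3) (mixedSpace L)) : Matrix (Fin 3) (Fin 3) (mixedSpace L)) *
        φ ((y : GL (Fin 3) (mixedSpace L)) * expGL (X : Matrix (Fin 3) (Fin 3) (mixedSpace L)))
    have hval : ContDiff ℝ ∞ fun X : (archGroupGL 3 L).lie.toSubmodule => (X : Matrix (Fin 3) (Fin 3) (mixedSpace L)) := (archGroupGL 3 L).lie.toSubmodule.subtypeL.contDiff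
    have h : (fun X : (archGroupGL 3 L).lie.toSubmodule =>
        Ψ (((y : GL (Fin 3) (mixedSpace L)) * expGL (X : Matrix (Fin 3) (Fin 3) (mixedSpace L)) : GL (Fin 3) (mixedSpace L)) : Matrix (Fin 3) (Fin 3) (mixedSpace L)) *
          φ ((y : GL (Fin 3) (mixedSpace L)) * expGL (X : Matrix (Fin 3) (Fin 3) (mixedSpace L)))) =
        fun X : (archGroupGL 3 L).lie.toSubmodule =>
          Ψ (((y : GL (Fin 3) (mixedSpace L)) : Matrix (Fin 3) (Fin 3) (mixedSpace L)) * NormedSpace.exp (X : Matrix (Fin 3) (Fin 3) (mixedSpace L))) *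
            Θ (((y : GL (Fin 3) (mixedSpace L)) : Matrix (Fin 3) (Fin 3) (mixedSpace L)) * NormedSpace.exp (X : Matrix (Fin 3) (Fin 3) (mixedSpace L))) := by
      funext X; rw [hΘφ, Units.val_mul, coe_expGL]
    rw [h]
    have hexp : ContDiff ℝ ∞ fun X : (archGroupGL 3 L).lie.toSubmodule =>
        ((y : GL (Fin 3) (mixedSpace L)) : Matrix (Fin 3) (Fin 3) (mixedSpace L)) * NormedSpace.exp (X : Matrix (Fin 3) (Fin 3) (mixedSpace L)) :=
      contDiff_const.mul (contDiff_exp_matrix_mixedSpace.comp hval)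
    exact (hΨ.comp hexp).mul (hΘ.comp hexp)
  · show Ψ _ * a' k = Ψ _ * φ (k : GL (Fin 3) (mixedSpace L))
    rw [hφa]

/-- **REAL POST-COMPOSITION**: if `k ↦ (f k : ℂ)` is `ArchSmooth` (`f` real) and `G : ℝ → ℝ` is `C^∞` with `G 0 = 0`, then `k ↦ (G (f k) : ℂ)` is `ArchSmooth` — witness `g ↦ G (re (φ g))`
(compact support because `G 0 = 0`). [cite: BorelJacquet1979, §4.1] -/
theorem ArchSmooth.comp_real {f : ↥(arch (↥(maximalRealSubfield L)) L (IsCMField.complexConj L) 3 (Matrix.diagonal α)) → ℝ}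
    (hf : ArchSmooth L 3 (Matrix.diagonal α) (fun k => ((f k : ℝ) : ℂ))) {G : ℝ → ℝ} (hG : ContDiff ℝ ∞ G) (hG0 : G 0 = 0) :
    ArchSmooth L 3 (Matrix.diagonal α) (fun k => ((G (f k) : ℝ) : ℂ)) := by
  obtain ⟨φ, hφc, hφs, hφsm, hφa⟩ := hf
  have hG' : ContDiff ℝ ∞ fun z : ℂ => ((G z.re : ℝ) : ℂ) := ofRealCLM.contDiff.comp (hG.comp reCLM.contDiff)
  refine ⟨fun g => ((G (φ g).re : ℝ) : ℂ), ?_, ?_, fun y => hG'.comp (hφsm y), fun k => ?_⟩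
  · exact continuous_ofReal.comp (hG.continuous.comp (continuous_re.comp hφc))
  · exact hφs.comp_left (g := fun z : ℂ => ((G z.re : ℝ) : ℂ)) (by rw [Complex.zero_re, hG0, Complex.ofReal_zero])
  · show ((G (f k) : ℝ) : ℂ) = ((G (φ (k : GL (Fin 3) (mixedSpace L))).re : ℝ) : ℂ)
    rw [← hφa k, Complex.ofReal_re]

end Ambient

/-! ## §2 Plateau functions: a real `ArchSmooth` function equal to `1` on a compact set -/

section Plateau

variable (L : Type) [Field L] [NumberField L] [IsCMField L] (α : Fin 3 → L)

/-- **PLATEAU FUNCTIONS IN `C_c^∞(G′_∞)`**: for every compact `E ⊆ G′_∞` there is a real `ArchSmooth` function `f` with `0 ≤ f ≤ 1` everywhere and `f = 1` on `E` — ★ F5's non-negative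
function positive on `E` (★ `exists_real_archSmooth_pos_on`), divided by its positive minimum on `E` and pushed through Mathlib's `Real.smoothTransition` (`= 1` on `[1, ∞)`, `= 0` at `0`).
[cite: Bouaziz1994IntegralesOrbitales, §2.3 p. 578] [cite: BorelJacquet1979, §4.1] -/
theorem exists_real_archSmooth_eq_one_on {E : Set ↥(arch (↥(maximalRealSubfield L)) L (IsCMField.complexConj L) 3 (Matrix.diagonal α))} (hE : IsCompact E) :
    ∃ f : ↥(arch (↥(maximalRealSubfield L)) L (IsCMField.complexConj L) 3 (Matrix.diagonal α)) → ℝ,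
      Continuous f ∧ (∀ k, 0 ≤ f k ∧ f k ≤ 1) ∧ (∀ k ∈ E, f k = 1) ∧ ArchSmooth L 3 (Matrix.diagonal α) (fun k => ((f k : ℝ) : ℂ)) := by
  obtain ⟨f₀, hf₀c, hf₀0, hf₀E, hf₀a⟩ := exists_real_archSmooth_pos_on L α hE
  -- a positive lower bound of `f₀` on `E`
  obtain ⟨m, hm, hmE⟩ : ∃ m : ℝ, 0 < m ∧ ∀ k ∈ E, m ≤ f₀ k := by
    rcases E.eq_empty_or_nonempty with hEe | hEn
    · exact ⟨1, one_pos, fun k hk => by rw [hEe] at hk; exact hk.elim⟩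
    · obtain ⟨k₀, hk₀, hmin⟩ := hE.exists_isMinOn hEn hf₀c.continuousOn
      exact ⟨f₀ k₀, hf₀E k₀ hk₀, fun k hk => hmin hk⟩
  refine ⟨fun k => Real.smoothTransition (m⁻¹ * f₀ k), Real.smoothTransition.continuous.comp (continuous_const.mul hf₀c),
    fun k => ⟨Real.smoothTransition.nonneg _, Real.smoothTransition.le_one _⟩, fun k hk => Real.smoothTransition.one_of_one_le ?_, ?_⟩
  · rw [← inv_mul_cancel₀ hm.ne']
    exact mul_le_mul_of_nonneg_left (hmE k hk) (inv_pos.2 hm).le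
  · exact ArchSmooth.comp_real L α hf₀a (G := fun t => Real.smoothTransition (m⁻¹ * t)) (Real.smoothTransition.contDiff.comp (contDiff_const.mul contDiff_id))
      (by rw [mul_zero, Real.smoothTransition.zero_of_nonpos le_rfl])

end Plateau

/-! ## §3 Tensors of one-place test functions -/

section Tensor

variable (L : Type) [Field L] [NumberField L] [IsCMField L] (α : Fin 3 → L)
  (F : ∀ w : {w : InfinitePlace L // IsComplex w}, ↥(archLocal L 3 (Matrix.diagonal α) w) → ℂ)

-- the scoped `ℓ^∞`-operator norm on `M₃(L ⊗ ℝ)` (the one through which ★ `IsArchSmooth` is defined)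
open scoped Matrix.Norms.Operator

/-- The tensor of continuous one-place functions is continuous. [cite: BorelJacquet1979, §4.1] -/
theorem continuous_tensor (hFc : ∀ w, Continuous (F w)) :
    Continuous fun k : ↥(arch (↥(maximalRealSubfield L)) L (IsCMField.complexConj L) 3 (Matrix.diagonal α)) => ∏ w, F w (archPiEquivCM 3 L (Matrix.diagonal α) k w) :=
  continuous_finsetProd _ fun w _ => (hFc w).comp ((continuous_apply w).comp (archPiEquivCM 3 L (Matrix.diagonal α)).continuous)

/-- **The tensor vanishes off `e⁻¹(Π_w tsupport f_w)`.** [cite: BorelJacquet1979, §4.1] -/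
theorem tensor_eq_zero_of_not_mem {k : ↥(arch (↥(maximalRealSubfield L)) L (IsCMField.complexConj L) 3 (Matrix.diagonal α))}
    (hk : k ∉ ⇑(archPiEquivCM 3 L (Matrix.diagonal α)) ⁻¹' Set.pi Set.univ (fun w => tsupport (F w))) :
    ∏ w, F w (archPiEquivCM 3 L (Matrix.diagonal α) k w) = 0 := by
  simp only [Set.mem_preimage, Set.mem_univ_pi, not_forall] at hk
  obtain ⟨w, hw⟩ := hk
  exact Finset.prod_eq_zero (Finset.mem_univ w) (image_eq_zero_of_notMem_tsupport hw)

/-- The tensor of compactly supported one-place functions is compactly supported (inside the compact `e⁻¹(Π_w tsupport f_w)`). [cite: BorelJacquet1979, §4.1] -/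
theorem hasCompactSupport_tensor (hFs : ∀ w, HasCompactSupport (F w)) :
    HasCompactSupport fun k : ↥(arch (↥(maximalRealSubfield L)) L (IsCMField.complexConj L) 3 (Matrix.diagonal α)) => ∏ w, F w (archPiEquivCM 3 L (Matrix.diagonal α) k w) :=
  HasCompactSupport.intro ((archPiEquivCM 3 L (Matrix.diagonal α)).toHomeomorph.isCompact_preimage.2 (isCompact_univ_pi fun w => (hFs w).isCompact))
    fun _ hk => tensor_eq_zero_of_not_mem L α F hk

/-- **The tensor is the restriction of the ambient function `X ↦ Π_w fa_w((X_{ij})_w)` on `M₃(L ⊗ ℝ)`** (★ `snd_coe_coe_apply`: the entries of the place component are the `w`-coordinates of the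
entries). [cite: BorelJacquet1979, §4.1] -/
theorem tensor_eq_ambient (fa : {w : InfinitePlace L // IsComplex w} → Matrix (Fin 3) (Fin 3) ℂ → ℂ)
    (hF : ∀ w (g : ↥(archLocal L 3 (Matrix.diagonal α) w)), F w g = fa w ((g : GL (Fin 3) ℂ) : Matrix (Fin 3) (Fin 3) ℂ))
    (k : ↥(arch (↥(maximalRealSubfield L)) L (IsCMField.complexConj L) 3 (Matrix.diagonal α))) :
    ∏ w, F w (archPiEquivCM 3 L (Matrix.diagonal α) k w) =
      ∏ w, fa w (Matrix.of fun i j => ((((k : GL (Fin 3) (mixedSpace L)) : Matrix (Fin 3) (Fin 3) (mixedSpace L)) i j).2 w)) :=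
  Finset.prod_congr rfl fun w _ => by
    rw [hF]
    exact congrArg (fa w) (Matrix.ext fun i j => by rw [Matrix.of_apply]; exact (snd_coe_coe_apply L α k w i j).symm)

/-- **THE TENSOR OF ONE-PLACE TEST FUNCTIONS IS IN `C_c^∞(G′_∞)`** (the (E2)∕(GT) item «`archSmooth_tensor`»): if every `f_w : U(α)_w → ℂ` is the restriction of an ambient `C^∞` function
`fa_w` on `M₃(ℂ)` and has compact support, then `k ↦ Π_w f_w((e k)_w)` is `ArchSmooth L 3 (diag α)`.  PROOF: the tensor equals `(Ψ ∘ val) · 𝟙` with `Ψ(X) = Π_w fa_w((X_{ij})_w)` ambient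
`C^∞` (★ `contDiff_apply_snd_apply`) and `𝟙` the plateau function of §2 on the compact `e⁻¹(Π_w tsupport f_w)` carrying its support; §1 `ArchSmooth.ambientMul`.
[cite: BorelJacquet1979, §4.1] [cite: Rogawski1990, §14.2 p. 233] -/
theorem archSmooth_tensor (fa : {w : InfinitePlace L // IsComplex w} → Matrix (Fin 3) (Fin 3) ℂ → ℂ) (hfa : ∀ w, ContDiff ℝ ∞ (fa w))
    (hF : ∀ w (g : ↥(archLocal L 3 (Matrix.diagonal α) w)), F w g = fa w ((g : GL (Fin 3) ℂ) : Matrix (Fin 3) (Fin 3) ℂ)) (hFs : ∀ w, HasCompactSupport (F w)) :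
    ArchSmooth L 3 (Matrix.diagonal α) fun k : ↥(arch (↥(maximalRealSubfield L)) L (IsCMField.complexConj L) 3 (Matrix.diagonal α)) => ∏ w, F w (archPiEquivCM 3 L (Matrix.diagonal α) k w) := by
  -- the compact carrier of the support and its plateau function
  have hK : IsCompact (⇑(archPiEquivCM 3 L (Matrix.diagonal α)) ⁻¹' Set.pi Set.univ (fun w => tsupport (F w))) :=
    (archPiEquivCM 3 L (Matrix.diagonal α)).toHomeomorph.isCompact_preimage.2 (isCompact_univ_pi fun w => (hFs w).isCompact)
  obtain ⟨pl, -, -, hpl1, hpla⟩ := exists_real_archSmooth_eq_one_on L α hK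
  -- the ambient product
  -- the place-`w` coordinate matrix is an `ℝ`-linear (hence `C^∞`) map `M₃(L ⊗ ℝ) → M₃(ℂ)` (as ★ `contDiff_apply_snd_apply`, matrix-valued)
  haveI : FiniteDimensional ℝ (Matrix (Fin 3) (Fin 3) (mixedSpace L)) := finiteDimensional_matrix_mixedSpace
  have hlin : ∀ w : {w : InfinitePlace L // IsComplex w}, ContDiff ℝ ∞ fun X : Matrix (Fin 3) (Fin 3) (mixedSpace L) => Matrix.of fun i j => (X i j).2 w := fun w =>
    (LinearMap.toContinuousLinearMap
      (⟨⟨fun X : Matrix (Fin 3) (Fin 3) (mixedSpace L) => Matrix.of fun i j => (X i j).2 w, fun _ _ => rfl⟩, fun _ _ => rfl⟩ :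
        Matrix (Fin 3) (Fin 3) (mixedSpace L) →ₗ[ℝ] Matrix (Fin 3) (Fin 3) ℂ)).contDiff
  have hΨ : ContDiff ℝ ∞ fun X : Matrix (Fin 3) (Fin 3) (mixedSpace L) => ∏ w, fa w (Matrix.of fun i j => (X i j).2 w) :=
    contDiff_prod fun w _ => (hfa w).comp (hlin w)
  have h := ArchSmooth.ambientMul L α hpla hΨ
  have heq : (fun k : ↥(arch (↥(maximalRealSubfield L)) L (IsCMField.complexConj L) 3 (Matrix.diagonal α)) =>
      (∏ w, fa w (Matrix.of fun i j => ((((k : GL (Fin 3) (mixedSpace L)) : Matrix (Fin 3) (Fin 3) (mixedSpace L)) i j).2 w))) * ((pl k : ℝ) : ℂ)) =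
      fun k => ∏ w, F w (archPiEquivCM 3 L (Matrix.diagonal α) k w) := by
    funext k
    rw [← tensor_eq_ambient L α F fa hF]
    by_cases hk : k ∈ ⇑(archPiEquivCM 3 L (Matrix.diagonal α)) ⁻¹' Set.pi Set.univ (fun w => tsupport (F w))
    · rw [hpl1 k hk, Complex.ofReal_one, mul_one]
    · rw [tensor_eq_zero_of_not_mem L α F hk, zero_mul]
  rw [heq] at h
  exact h

end Tensor

end Literature.NumberTheory.Rogawski1990
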